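import Mathlib
import HarnessLib
import HarnessLib.Audit
import Summits.NavierStokesRegularity.Statement
import Literature.Analysis.FluidPDE.ClassicalSolution
import Literature.Analysis.FluidPDE.LerayHopf
import Literature.Analysis.FluidPDE.VectorCalculus
import Literature.Analysis.FluidPDE.SuitableWeak
import Literature.Analysis.FluidPDE.AxisymmetricEuler
import Literature.Analysis.FluidPDE.NSWave0
import Summits.NavierStokesRegularity.NavierStokesRegularity.Theorems.TypeICertificateLadderNoBlowupToClay
import HarnessLib.Audit.Status.Attr

/-!
Route: FlatSwirlGauge

DORMANT since 2026-08-29T19:39:31Z (census g0: costume|duplicate of —; reader census-reader-51-g0) — unstaffed, not closed; items shared with open routes are served there. `ledger route dormant <id> --off` reactivates.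

# Route FlatSwirlGauge — NavierStokesRegularity (Clay A), positive side (geometric /
gauge-theoretic); realises idea card clebsch-connection-flat-gauge-swirl ("swirl without symmetry");
POSITS A NEW OBJECT (the flat swirl gauge)

## Thesis X = FG ∧ CSR
The one critical (scale-invariant, L^∞) a-priori bound known for 3-D Navier–Stokes is the swirl
maximum principle |Γ(t)| ≤ ‖Γ₀‖_∞, Γ = r u_θ, of axisymmetric flow. What it really uses: Γ is a
FIRST INTEGRAL of the vorticity (ω·∇Γ = 0, i.e. one flux/Clebsch coordinate of ω) and obeys a PURE
drift–diffusion law (∂_t + u·∇)Γ = ν(Δ − (2/r)∂_r)Γ (KNSS2009 (1.8) = in-tree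
`Literature.Analysis.FluidPDE.swirl_transport`, proved) — literally Cowling's flux-function equation
of the axisymmetric anti-dynamo theorem. In a local Clebsch chart ω = ∇α × ∇β of ANY flow, NS moves
α by heat flow plus a connection term nonlocal along vortex lines (Constantin2001's diffusive
Weber–Clebsch connection; Sato2021 §4 eq. DO); "flat" = the connection reduces to a drift b·∇α with
an axis-type bound |b| ≲ 1/d off a thin (one-dimensional) degeneracy set {d = 0}. Symmetry is only
the cheapest way to be flat.
De-symmetrised object (v0 rendering, INLINED verbatim in every decl so that all signatures elaborate
today): a FLAT SWIRL GAUGE for u on a backward cylinder Q_ρ(T,x₀) = (T−ρ²,T)×B_ρ(x₀) is data (α, b,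
d, C₀, M) with α ∈ C²(Q), |α| ≤ M; ω·∇α = 0 on Q; where d > 0: |ω| d ≤ C₀|∇α| (chart nondegeneracy:
the conjugate gradient ω×∇α/|∇α|² is ≤ C₀/d), |b| d ≤ C₀ and (∂_t + u·∇)α = ν(Δα + b·∇α) (flat
connection ⇒ maximum principle); and vol({d < δ} ∩ B_ρ(x₀)) ≤ C₀ δ² ρ for 0 < δ < ρ (the degeneracy
set is axis-like). All constants are invariant under the NS scaling (α has the dimension of
circulation).
FG (decl FlatGaugeAtSingularity): ν>0, (u,p) classical on ℝ³×[0,T), Leray–Hopf from a rapidly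
decaying datum, u unbounded on every backward cylinder at (T,x₀) ⇒ a flat swirl gauge exists on some
Q_ρ(T,x₀).
CSR (decl CriticalSwirlRegularity): same class; a flat swirl gauge on some Q_ρ(T,x₀) ⇒ u bounded on
some (T−r²,T)×B_r(x₀).
Lean: X = FlatGaugeAtSingularity ∧ CriticalSwirlRegularity; every decl of the route elaborates
(planner Sketch.lean, lean check rc 0).

## Assembly X → NavierStokesRegularity (PURE LOGIC, proved in Sketch.lean)
Assembly := FlatGaugeAtSingularity → CriticalSwirlRegularity → LocalBoundedExtends → NoBlowupToClay
→ NavierStokesRegularity. Proof: NoBlowupToClay (= shared stmt-NavierStokesRegularity-0055) reduces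
Clay (A) to NoBlowup; LocalBoundedExtends (support: CKN far field + compactness + L^∞ continuation)
reduces NoBlowup on [0,T) to boundedness of u on a backward cylinder at every (T,x₀); at each x₀
either that holds or FG gives a flat gauge and CSR gives boundedness.
Type-I variant (support TypeIAssembly, also pure logic): FlatGaugeAtSingularity →
FlatGaugeExcludesTypeI → NoTypeII (= stmt-NavierStokesRegularity-0056, crux of route TypeILiouville)
→ LocalBoundedExtends → NoBlowupToClay → NavierStokesRegularity.

## Two-layer plan (D-0019)
Layer 1 now: cruxes FG (rank 2), CSR (rank 3), FlatGaugeExcludesTypeI (rank 4); supports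
LocalBoundedExtends, NoBlowupToClay, NoTypeII, TypeIAssembly, AxisymmetricSwirlFlat (anchor: the
exactly-flat case of the rendering is the proved identity swirl_transport + ω·∇Γ = 0). Layer 2 only
after a crux closes: split CSR into (flat-class ε-regularity at the degeneracy set) + (interior De
Giorgi/Harnack for the momentum α with div-free drift), or split FG into (existence of a first
integral near a singularity) + (flatness of its transport defect). Definition request
HasFlatSwirlGauge packages the inline block; a later restatement over it changes no meaning.

Rationale: WHY THIS LINE. Imports gauge theory / MHD kinematics (Cowling's anti-dynamo flux equation, Clebsch =
flux coordinates, connection & curvature) into NS regularity with an explicit dictionary: poloidal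
field B_p = ∇×(χ/r e_θ) ↦ poloidal vorticity ω_p = ∇×(u_θ e_θ); flux function χ ↦ Γ = r u_θ; Dχ/Dt =
λ∇*²χ ↦ DΓ/Dt = ν∇*²Γ (KNSS2009 (1.8), in-tree swirl_transport_holds); Clebsch pair ↦ (α,β) with ω =
∇α×∇β; viscous Weber–Clebsch connection (Constantin2001, Sato2021 §4) ↦ drift b; 'no axisymmetric
dynamo' ↦ maximum principle for α. It explains the partial-result landscape in one stroke
(translations ⇒ 2½-D passive scalar; rotations ⇒ Γ; screws ⇒ Lortz-type coupling, no maximum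
principle, MahalovTitiLeibovich1990 regular for another reason) and says what 'one level up from
axisymmetry' means: not less symmetry but a flat flux connection. Closing technology = critical
drift–diffusion at a degenerate set (KNSS2009 §5, SereginEtAl2012, LeiZhang2017, Wei2016,
ChenFangZhang2017), so progress on the axis problem transfers verbatim.
RANKED CRUXES. #2 FlatGaugeAtSingularity (FG): the new structural claim; most informative (its
exactly-flat instance is checkable on Hou2022PotentiallySingularNS profiles: is |ω_θ| ≲ |ω_p| on the
high-vorticity set?). #3 CriticalSwirlRegularity (CSR): hardest; contains the localised
axisymmetric-with-swirl problem in the poloidal-dominated regime. #4 FlatGaugeExcludesTypeI: CSR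
under a Type I rate; exactly-flat case is the PROVED Seregin–Šverák 2009 theorem (barrier fact
AxisymmetricTypeIExclusion), so 'de-symmetrise KNSS §5–6' is a concrete task; with NoTypeII
(stmt-0056) it also closes Clay (A) (support TypeIAssembly).
SUPPORTS. LocalBoundedExtends (standard continuation: CKN far field + compactness + L^∞ ⇒
extension), NoBlowupToClay (= stmt-0055), NoTypeII (= stmt-0056), TypeIAssembly (pure logic, proved
in Sketch), AxisymmetricSwirlFlat (anchor: Γ satisfies the first-integral and flat-transport clauses
verbatim — swirl_transport_holds + ω·∇Γ = 0; if unprovable the rendering is wrong and FG/CSR get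
restated).
KILL CRITERIA. (K1) An axisymmetric finite-energy blow-up (route CertifiedBlowup;
Hou2022PotentiallySingularNS, Hou2026) whose profile satisfies the v0 gauge refutes CSR and closes
the positive reading (the necessary-condition reading 'singular ⇒ flat or chart-degenerate' survives
as a design constraint only). (K2) If at Hou's near-singular profile sup |ω_θ| r/|∇Γ| on {|ω| ≥ ½
sup|ω|} grows without bound (a kit job any refuter can run), FG-v0 fails in the exactly-flat class:
restate FG over the gauge-optimised Clebsch connection defect (asymptotic flatness 𝔎(Q_r) → 0,
Sato2021 eq. DO) or close. (K3) ¬FlatGaugeExcludesTypeI by an explicit Type-I flat-gauge ancient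
solution (= NontrivialTypeIAncientExists with a global flat gauge) kills #4 and, via
AlbrittonBarker2019, Clay (A) itself.
DELIBERATELY NOT DECOMPOSED. The identity layer (Killing momenta (∂_t+u·∇−νΔ)(u·K) = −K·∇p −
2ν∇u:∇K; helical coupling r ω_z = ∂_r m + αω_θ; Sato's DO / the curvature density 𝒞_α in the flux
chart) — provers attach with --supports; the flat-class Liouville theorem (de-symmetrised
AxisymmetricLiouvilleBoundedSwirl) inside #4; how CSR is proved; the asymptotic-flatness refinement
and its notion (ClebschConnectionDefect) — requested only if K2 fires. One definition request now:
HasFlatSwirlGauge (packages the inline v0 block + scaling/restriction API + the axisymmetric anchor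
lemma).
NOVELTY and BARRIERS: see the dedicated sections (passed as --novelty/ --barriers; nearest prior
Constantin2001, Sato2021, Ohkitani2018, KNSS2009, SereginSverak2009; barriers EnergySupercriticality
met at FG/CSR, TaoAveragedBlowup evaded in form, AxisymmetricTypeIExclusion exploited,
CriticalNormBlowupNecessity consistent).

Novelty: NOVELTY. Nearest prior art: Constantin2001 (Eulerian–Lagrangian NS: the diffusive Weber–Clebsch
connection exists; regularity ⇔ controlled resettings), Sato2021 (NS as transport–diffusion of a
complete set of Clebsch potentials; the diffusion operator differs from Δ by a Lie-bracket
connection integrated along the conjugate coordinate, §4 eq. DO), Ohkitani2018 (Euler: Clebsch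
depletion, 'rule out singularity for flows with Clebsch potentials everywhere'), KNSS2009 /
LeiZhang2017 / Wei2016 / ChenFangZhang2017 (Γ = r u_θ as the critical scalar — axisymmetric only),
SereginSverak2009 (axisymmetric Type I exclusion), MahalovTitiLeibovich1990 (helical class regular
for a different reason; no swirl maximum principle). DELTA: (i) 'swirl maximum principle = flatness
(pure axis-type drift) of the viscous Clebsch connection = Cowling's flux-function equation' is not
in print; (ii) the flat swirl gauge (α a first integral of ω with flat transport, chart
nondegeneracy |ω| d ≲ |∇α|, one-dimensional degeneracy set) as the de-symmetrised Γ is a new object;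
(iii) the reductions FG ∧ CSR → Clay (A) and FG ∧ FlatGaugeExcludesTypeI ∧ NoTypeII → Clay (A) are
new combinations of known infrastructure (viscous Clebsch transport; critical drift–diffusion
SereginEtAl2012; KNSS Liouville). Expected grade: new-combination (the card was so graded by
refuter-novelty-audit-NavierStokesRegularity-NavierStokesRegularity-7-0, whose uncited nearest prior
Sato2021 is now cited).
Searched (this session): lit se  [refs: 10.1016/j.physleta.2016.07.066, 10.1063/5.0035339, 10.1016/j.camwa.2018.06.035, 10.1002/cpa.20212, 0804.3602, doi:10.1016/j.physleta.2016.07.066, doi:10.1063/5.0035339, doi:10.1016/j.camwa.2018.06.035, doi:10.1002/cpa.20212, Constantin2001, Sato2021, Ohkitani2018, KNSS2009, LeiZhang2017, Wei2016, ChenFangZhang2017, SereginSverak2009, MahalovTitiLeibovich1990, SereginEtAl2012, Hou2026]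

Barriers (technique_class: gauge-fixing, maximum-principle, critical-drift-diffusion): BARRIERS (catalogue Literature/Barriers/NavierStokesRegularity read: 22 files; technique_class:
gauge-fixing, maximum-principle, critical-drift-diffusion, clebsch-variables).
- Literature.Barriers.NavierStokesRegularity.EnergySupercriticality: met head-on, not dodged. The
payoff of FG is a CRITICAL controlled quantity — sup|α| is invariant under u ↦ λu(λ²t,λx) (α has the
dimension of circulation) and is controlled by a parabolic maximum principle in the flat gauge,
never by the energy: Tao's 'Strategy 2' realised conditionally. The supercritical gap is relocated,
honestly, into FG (why should singular geometry be flat?) and CSR (critical ⇒ regular, open already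
in the exactly-flat axisymmetric class).
- Literature.Barriers.NavierStokesRegularity.TaoAveragedBlowup (with TruncatedDyadicBlowup): evaded
in form. FG, CSR and FlatGaugeExcludesTypeI are statements about the Lie-transport
(Kelvin/Cauchy/Clebsch) structure of the exact nonlinearity P(ω×u): first integrals of ω transported
modulo a viscous connection. An averaged bilinear operator B̃ has no vortex lines, no flux
coordinates and no swirl law, so none of the decls can even be stated for Tao's averaged equation;
the argument class is 'fine algebraic structure of B' (Tao2016AveragedNS p.8 lists it outside the
barrier). No energy identity or function-space estimate is the coercive input.
- Literature.Barriers.NavierStokesRegularity.AxisymmetricTypeIExclusion: consistent and exploited —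
crux FlatGaugeExcludesTypeI is its de-

History (route lifecycle, newest last):
- 2026-08-29T19:39:31Z · DORMANT — census g0: costume|duplicate of —; reader census-reader-51-g0 (operator:999:1543497)

sub-problem: NavierStokesRegularity · status: dormant · opened planner-plancard-NavierStokesRegularity-Navie-001fffd8-0 2026-08-15T10:54:02Z · rev 2 · ledger route-NavierStokesRegularity-FlatSwirlGauge
GENERATED by the gate from the ledger (D-0016/17). Provers cite these decls: `theorem foo : Summit.NavierStokesRegularity.NavierStokesRegularity.Theses.FlatSwirlGauge.<Decl> := …` in Summits/NavierStokesRegularity/NavierStokesRegularity/Theorems/<Name>.lean.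
-/

namespace Summit.NavierStokesRegularity.NavierStokesRegularity.Theses.FlatSwirlGauge

open scoped BigOperators Topology Manifold Classical MeasureTheory ProbabilityTheory Matrix InnerProductSpace ComplexConjugate ContinuousMap
open Filter Set Function TopologicalSpace MeasureTheory

attribute [summit_statement] _root_.NavierStokesRegularity

open Literature.NS

/-- item stmt-NavierStokesRegularity-1252 · crux · rank 2 · open · by planner
why it might fail: Needs a bounded C² first integral α of ω with ∇α≠0 a.e. on {ω≠0} on a FIXED cylinder up to T: chaotic (ABC-type) vortex lines admit no such α (DombreEtAl1986; ArnoldKhesin1998); even exactly-flat α=Γ needs r|ω_θ|≲|∇Γ| on the high-|ω| set, untested at Hou's profile arXiv:2107.06509.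
sources: Constantin2001, Sato2021, Ohkitani2018, KNSS2009, Hou2022PotentiallySingularNS, DombreEtAl1986
[crux] FLAT GAUGE AT A SINGULARITY (card FG; v0 rendering inlined). ν>0, (u,p) classical solution of
unforced NS on ℝ³×[0,T), Leray–Hopf from a rapidly decaying datum; if u is NOT bounded on any
backward cylinder (T−r²,T)×B_r(x₀), then on some Q_ρ(T,x₀)=(T−ρ²,T)×B_ρ(x₀) there is a flat swirl
gauge (α,b,d,C₀,M): α ∈ C²(Q) with |α| ≤ M (generalised swirl = Clebsch momentum, dimension of
circulation, so sup|α| is scale-invariant); ω·∇α = 0 on Q (α is a first integral of the vorticity =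
one flux coordinate); where d>0: |ω| d ≤ C₀|∇α| (chart nondegeneracy: the conjugate gradient ∇β =
ω×∇α/|∇α|² is ≤ C₀/d), (∂_t+u·∇)α = ν(Δα + b·∇α) with |b| d ≤ C₀ (FLAT connection = pure axis-type
drift ⇒ maximum principle for α); vol({d<δ}∩B_ρ(x₀)) ≤ C₀δ²ρ for 0<δ<ρ (degeneracy set
one-dimensional, axis-like). Exactly-flat model: axisymmetric u, α = Γ = r u_θ, b = −(2/r)e_r, d = r
(KNSS2009 (1.8) = Literature.Analysis.FluidPDE.swirl_transport, Cowling's flux-function equation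
Dχ/Dt = λ∇*²χ), valid where |ω_θ| ≲ |ω_p| = |∇Γ|/r. General chart: Constantin2001 (diffusive
Weber–Clebsch connection), Sato2021 §4 eq. DO (heat flow + bracket connection integrated along the
conjugate coordinate); flat = that con -/
@[route_item "route-NavierStokesRegularity-FlatSwirlGauge", crux]
def FlatGaugeAtSingularity : Prop :=
  ∀ (ν T : ℝ), 0 < ν → 0 < T → ∀ (u : ℝ → EuclideanSpace ℝ (Fin 3) → EuclideanSpace ℝ (Fin 3)) (p : ℝ → EuclideanSpace ℝ (Fin 3) → ℝ), Literature.Analysis.FluidPDE.IsClassicalNSSolutionOn (Set.Ico 0 T) ν 0 u p → Literature.Analysis.FluidPDE.IsLerayHopfOn T ν 0 (u 0) u → Literature.Analysis.FluidPDE.HasRapidSpatialDecay (u 0) → ∀ x₀ : EuclideanSpace ℝ (Fin 3), ¬ (∃ r : ℝ, 0 < r ∧ ∃ K : ℝ, ∀ t ∈ Set.Ioo (T - r ^ 2) T, 0 ≤ t → ∀ x ∈ Metric.ball x₀ r, ‖u t x‖ ≤ K) → ∃ (ρ C₀ M : ℝ) (α : ℝ → EuclideanSpace ℝ (Fin 3)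 → ℝ) (b : ℝ → EuclideanSpace ℝ (Fin 3) → EuclideanSpace ℝ (Fin 3)) (d : ℝ → EuclideanSpace ℝ (Fin 3) → ℝ), 0 < ρ ∧ ρ ^ 2 < T ∧ ContDiffOn ℝ 2 (Function.uncurry α) (Set.Ioo (T - ρ ^ 2) T ×ˢ Metric.ball x₀ ρ) ∧ (∀ t ∈ Set.Ioo (T - ρ ^ 2) T, ∀ δ ∈ Set.Ioo 0 ρ, MeasureTheory.volume ({x | d t x < δ} ∩ Metric.ball x₀ ρ) ≤ ENNReal.ofReal (C₀ * δ ^ 2 * ρ)) ∧ (∀ t ∈ Set.Ioo (T - ρ ^ 2) T, ∀ x ∈ Metric.ball x₀ ρ, |α t x| ≤ M ∧ inner ℝ (Literature.Analysis.FluidPDE.curl (u t) x) (gradient (α t) x) = 0 ∧ (0 < d t x → ‖Literature.Analysis.FluidPDE.curl (u t) x‖ * d t x ≤ C₀ * ‖gradient (α t) x‖ ∧ ‖b t x‖ * d t x ≤ C₀ ∧ deriv (fun s => α s x) t + Literature.Analysis.FluidPDE.convect (u t) (α t) x = ν * (Laplacian.laplacian (α t) x + inner ℝ (b t x) (gradient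 (α t) x))))

/-- item stmt-NavierStokesRegularity-1253 · crux · rank 3 · open · by planner
why it might fail: Contains the localised axisymmetric-with-swirl problem (α=Γ; open): an axisymmetric blow-up in the gauge (Hou arXiv:2107.06509) refutes it; typed thinness ≤C₀δ²ρ tied to ρ: {d<δ}⊇B_{(C₀ρδ²)^{1/3}}(x₀) allowed, so |ω|,|b| bounds are supercritical at x₀; no Harnack past BMO⁻¹ drift (SereginEtAl2012).
sources: KNSS2009, LeiZhang2017, Wei2016, ChenFangZhang2017, SereginEtAl2012, Hou2022PotentiallySingularNS
[crux] CRITICAL SWIRL REGULARITY (card CSR; v0). Same class of solutions; if (u,p) admits a flat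
swirl gauge on some backward cylinder Q_ρ(T,x₀) (the clauses of FlatGaugeAtSingularity's conclusion,
verbatim), then u is bounded on some (T−r²,T)×B_r(x₀). The exactly-flat case is the LOCALISED
axisymmetric-with-swirl regularity problem in the poloidal-dominated regime (there Γ bounded is
automatic by the maximum principle; cf. the open
Literature.Analysis.FluidPDE.AxisymmetricSwirlRegularity) — this crux is at least that hard.
Technology: critical drift–diffusion with divergence-free drift at a degenerate, axis-like set —
KNSS2009 Thms 5.2–5.3 (Liouville via maximum principles for r u_θ, ω_θ/r), SereginEtAl2012
(Harnack/Liouville for div-free drifts in BMO⁻¹), LeiZhang2017 Thm 1.2/Cor 1.3 (criticality of Γ: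
regularity once |Γ| ≤ C|ln r|^{-2} near the axis), Wei2016 and ChenFangZhang2017 (log-modulus
criteria on Γ). The bounded momentum α with its maximum principle is a CRITICAL (scale-invariant
L^∞) quantity; the claim is that with the chart nondegeneracy |ω| d ≲ |∇α| it forces local
boundedness of u (ESS/Seregin currency). -/
@[route_item "route-NavierStokesRegularity-FlatSwirlGauge", crux]
def CriticalSwirlRegularity : Prop :=
  ∀ (ν T : ℝ), 0 < ν → 0 < T → ∀ (u : ℝ → EuclideanSpace ℝ (Fin 3) → EuclideanSpace ℝ (Fin 3)) (p : ℝ → EuclideanSpace ℝ (Fin 3) → ℝ), Literature.Analysis.FluidPDE.IsClassicalNSSolutionOn (Set.Ico 0 T) ν 0 u p → Literature.Analysis.FluidPDE.IsLerayHopfOn T ν 0 (u 0) u → Literature.Analysis.FluidPDE.HasRapidSpatialDecay (u 0) → ∀ x₀ : EuclideanSpace ℝ (Fin 3), (∃ (ρ C₀ M : ℝ) (α : ℝ → EuclideanSpace ℝ (Fin 3) → ℝ) (b : ℝ → EuclideanSpace ℝ (Fin 3) → EuclideanSpace ℝ (Fin 3)) (d : ℝ → EuclideanSpace ℝ (Fin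 3) → ℝ), 0 < ρ ∧ ρ ^ 2 < T ∧ ContDiffOn ℝ 2 (Function.uncurry α) (Set.Ioo (T - ρ ^ 2) T ×ˢ Metric.ball x₀ ρ) ∧ (∀ t ∈ Set.Ioo (T - ρ ^ 2) T, ∀ δ ∈ Set.Ioo 0 ρ, MeasureTheory.volume ({x | d t x < δ} ∩ Metric.ball x₀ ρ) ≤ ENNReal.ofReal (C₀ * δ ^ 2 * ρ)) ∧ (∀ t ∈ Set.Ioo (T - ρ ^ 2) T, ∀ x ∈ Metric.ball x₀ ρ, |α t x| ≤ M ∧ inner ℝ (Literature.Analysis.FluidPDE.curl (u t) x) (gradient (α t) x) = 0 ∧ (0 < d t x → ‖Literature.Analysis.FluidPDE.curl (u t) x‖ * d t x ≤ C₀ * ‖gradient (α t) x‖ ∧ ‖b t x‖ * d t x ≤ C₀ ∧ deriv (fun s => α s x) t + Literature.Analysis.FluidPDE.convect (u t) (α t) x = ν * (Laplacian.laplacian (α t) x + inner ℝ (b t x) (gradient (α t) x))))) → ∃ r : ℝ, 0 < r ∧ ∃ K : ℝ, ∀ t ∈ Set.Ioo (T - r ^ 2) T, 0 ≤ t → ∀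 x ∈ Metric.ball x₀ r, ‖u t x‖ ≤ K

/-- item stmt-NavierStokesRegularity-1254 · crux · rank 4 · open · by planner
why it might fail: SS09 Thm 1.1 uses the whole axisymmetric system, not only Γ's maximum principle; the typed thinness clause (≤C₀δ²ρ on B_ρ only) rescales to C₀δ²ρ/λ→∞, so the KNSS zoom-in limit inherits no gauge near x₀, and bounded α passes only weakly-* (GigaMiura2011: uniform continuity is what survives Type I).
sources: SereginSverak2009, KNSS2009, GigaMiura2011, AlbrittonBarker2019, Literature.Barriers.NavierStokesRegularity.AxisymmetricTypeIExclusion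
[crux] FLAT GAUGE EXCLUDES TYPE I (de-symmetrised Seregin–Šverák). CriticalSwirlRegularity under the
extra hypothesis Literature.Analysis.FluidPDE.IsTypeIBlowup u T (‖u(t)‖_∞ ≤ C(T−t)^{-1/2}
eventually): a flat swirl gauge on a backward cylinder at (T,x₀) then forces boundedness of u near
(T,x₀). Exactly-flat case PROVED in print: Seregin–Šverák 2009 Thm 1.1/3.1 (axisymmetric + Type I ⇒
regular; barrier fact Literature.Barriers.NavierStokesRegularity.AxisymmetricTypeIExclusion,
conditionally proved in-tree; KNSS2009 Thms 5.2–5.3 and §6: zoom-in to a bounded ancient mild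
solution + Liouville). Task: run the KNSS/SS09 zoom-in at (T,x₀); the gauge constants C₀, M are
scale-invariant, so the blow-up limit inherits a GLOBAL flat gauge with bounded momentum; prove the
flat-class Liouville theorem (maximum principle for α, α = 0 forced on the degeneracy set, strong
maximum principle ⇒ α locally constant ⇒ by chart nondegeneracy ω = 0 off a null set ⇒ bounded
ancient curl-free div-free ⇒ constant, contradicting the Type-I normalisation |ū(0,0)| = 1 with
decay). With NoTypeII (stmt-NavierStokesRegularity-0056) this closes Clay (A) through TypeIAssembly. -/
@[route_item "route-NavierStokesRegularity-FlatSwirlGauge"]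
def FlatGaugeExcludesTypeI : Prop :=
  ∀ (ν T : ℝ), 0 < ν → 0 < T → ∀ (u : ℝ → EuclideanSpace ℝ (Fin 3) → EuclideanSpace ℝ (Fin 3)) (p : ℝ → EuclideanSpace ℝ (Fin 3) → ℝ), Literature.Analysis.FluidPDE.IsClassicalNSSolutionOn (Set.Ico 0 T) ν 0 u p → Literature.Analysis.FluidPDE.IsLerayHopfOn T ν 0 (u 0) u → Literature.Analysis.FluidPDE.HasRapidSpatialDecay (u 0) → Literature.Analysis.FluidPDE.IsTypeIBlowup u T → ∀ x₀ : EuclideanSpace ℝ (Fin 3), (∃ (ρ C₀ M : ℝ) (α : ℝ → EuclideanSpace ℝ (Fin 3) → ℝ) (b : ℝ → EuclideanSpace ℝ (Fin 3) → EuclideanSpace ℝ (Fin 3)) (d : ℝ → EuclideanSpace ℝ (Fin 3) → ℝ), 0 < ρ ∧ ρ ^ 2 < T ∧ ContDiffOn ℝ 2 (Function.uncurry α) (Set.Ioo (T - ρ ^ 2) T ×ˢ Metric.ball x₀ ρ) ∧ (∀ t ∈ Set.Ioo (T - ρ ^ 2) T, ∀ δ ∈ Set.Ioo 0 ρ, MeasureTheory.volume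 ({x | d t x < δ} ∩ Metric.ball x₀ ρ) ≤ ENNReal.ofReal (C₀ * δ ^ 2 * ρ)) ∧ (∀ t ∈ Set.Ioo (T - ρ ^ 2) T, ∀ x ∈ Metric.ball x₀ ρ, |α t x| ≤ M ∧ inner ℝ (Literature.Analysis.FluidPDE.curl (u t) x) (gradient (α t) x) = 0 ∧ (0 < d t x → ‖Literature.Analysis.FluidPDE.curl (u t) x‖ * d t x ≤ C₀ * ‖gradient (α t) x‖ ∧ ‖b t x‖ * d t x ≤ C₀ ∧ deriv (fun s => α s x) t + Literature.Analysis.FluidPDE.convect (u t) (α t) x = ν * (Laplacian.laplacian (α t) x + inner ℝ (b t x) (gradient (α t) x))))) → ∃ r : ℝ, 0 < r ∧ ∃ K : ℝ, ∀ t ∈ Set.Ioo (T - r ^ 2) T, 0 ≤ t → ∀ x ∈ Metric.ball x₀ r, ‖u t x‖ ≤ K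

/-- item stmt-NavierStokesRegularity-1255 · support · rank 8 · closed · proved by Summit.NavierStokesRegularity.NavierStokesRegularity.Theorems.flatSwirlGauge_localBoundedExtends_proof (prover) · by planner
sources: CKN1982, Leray1934, KNSS2009
[support] LOCAL-TO-GLOBAL CONTINUATION. ν>0, (u,p) classical on ℝ³×[0,T), Leray–Hopf from a rapidly
decaying datum; if every x₀ ∈ ℝ³ has a backward cylinder (T−r²,T)×B_r(x₀) (times t ≥ 0) on which u
is bounded, then u extends as a classical solution past T (HasSmoothExtensionPast). Standard: far
field by CKN ε-regularity (finite energy + Leray–Hopf ⇒ u ∈ L³((0,T)×ℝ³), p ∈ L^{3/2}, tails → 0 ⇒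
|u| ≤ C on (T−δ,T)×{|x|>R}; Literature.Analysis.FluidPDE.ckn_epsilon_regularity), near field by
compactness of the closed ball B_R, hence u ∈ L^∞((T−δ',T)×ℝ³), then (∞,∞)-Prodi–Serrin continuation
of the classical solution (ladyzhenskaya_prodi_serrin, weak_strong_uniqueness,
local_classical_lerayHopf). Same toolbox as stmt-NavierStokesRegularity-0055; may take those named
Literature facts as hypotheses if the grounder so rules. -/
@[route_item "route-NavierStokesRegularity-FlatSwirlGauge", crux]
def LocalBoundedExtends : Prop :=
  ∀ (ν T : ℝ), 0 < ν → 0 < T → ∀ (u : ℝ → EuclideanSpace ℝ (Fin 3) → EuclideanSpace ℝ (Fin 3)) (p : ℝ → EuclideanSpace ℝ (Fin 3) → ℝ), Literature.Analysis.FluidPDE.IsClassicalNSSolutionOn (Set.Ico 0 T) ν 0 u p → Literature.Analysis.FluidPDE.IsLerayHopfOn T ν 0 (u 0) u → Literature.Analysis.FluidPDE.HasRapidSpatialDecay (u 0) → (∀ x₀ : EuclideanSpace ℝ (Fin 3), ∃ r : ℝ, 0 < r ∧ ∃ K : ℝ, ∀ t ∈ Set.Ioo (T - r ^ 2) T, 0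 ≤ t → ∀ x ∈ Metric.ball x₀ r, ‖u t x‖ ≤ K) → Literature.Analysis.FluidPDE.HasSmoothExtensionPast ν 0 u T

-- `LocalBoundedExtends` holds: proved by `Summit.NavierStokesRegularity.NavierStokesRegularity.Theorems.flatSwirlGauge_localBoundedExtends_proof` (its module imports this route file, so no `_holds` link can be stated here).

/-- item stmt-NavierStokesRegularity-1256 · support · rank 8 · closed · proved by Summit.NavierStokesRegularity.NavierStokesRegularity.Theorems.flatSwirlGauge_axisymmetricSwirlFlat_proof (prover) · by planner
sources: KNSS2009, KochNadirashviliSereginSverak2009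
[support] ANCHOR OF THE v0 RENDERING (the exactly-flat case is an identity). For a classical NS
solution on [0,T) (any ν, f = 0) with axisymmetric velocity and axisymmetric pressure: Γ =
Literature.Analysis.FluidPDE.swirl (u t) satisfies (a) ω·∇Γ = 0 at every point (poloidal vorticity
ω_p = ∇^⊥Γ/r is tangent to the level sets of Γ; ω_θ e_θ ⊥ ∇Γ), and (b) off the axis and for 0<t<T
the flat-transport clause of the gauge with α = Γ, b = −(2/r)e_r: ∂_tΓ + (u·∇)Γ = ν(ΔΓ + ⟪−(2/r)e_r,
∇Γ⟫). (b) is KNSS2009 eq. (1.8) = Literature.Analysis.FluidPDE.swirl_transport (PROVED in-tree: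
swirl_transport_holds) after identifying deriv = derivWithin (Ico 0 T) at interior times
(IsSmoothSpaceTimeOn), ⟪e_r, ∇Γ⟫ = partialDeriv (eR x) Γ x, and swirl 0 = 0. If this support is NOT
provable as stated, the inline gauge clauses are mis-rendered and the planner must restate
FG/CSR/FlatGaugeExcludesTypeI. -/
@[route_item "route-NavierStokesRegularity-FlatSwirlGauge"]
def AxisymmetricSwirlFlat : Prop :=
  ∀ (ν T : ℝ) (u : ℝ → EuclideanSpace ℝ (Fin 3) → EuclideanSpace ℝ (Fin 3)) (p : ℝ → EuclideanSpace ℝ (Fin 3) → ℝ), Literature.Analysis.FluidPDE.IsClassicalNSSolutionOn (Set.Ico 0 T) ν 0 u p → (∀ t ∈ Set.Ico 0 T, Literature.Analysis.FluidPDE.IsAxisymmetric (u t)) → (∀ t ∈ Set.Ico 0 T, Literature.Analysis.FluidPDE.IsAxisymmetricScalar (p t)) → ∀ t ∈ Set.Ioo 0 T, ∀ x : EuclideanSpace ℝ (Fin 3), inner ℝ (Literature.Analysis.FluidPDE.curl (u t) x) (gradient (Literature.Analysis.FluidPDE.swirl (u t)) x) = 0 ∧ (Literature.Analysis.FluidPDE.cylRadius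 x ≠ 0 → deriv (fun s => Literature.Analysis.FluidPDE.swirl (u s) x) t + Literature.Analysis.FluidPDE.convect (u t) (Literature.Analysis.FluidPDE.swirl (u t)) x = ν * (Laplacian.laplacian (Literature.Analysis.FluidPDE.swirl (u t)) x + inner ℝ ((-(2 / Literature.Analysis.FluidPDE.cylRadius x)) • Literature.Analysis.FluidPDE.eR x) (gradient (Literature.Analysis.FluidPDE.swirl (u t)) x)))

-- `AxisymmetricSwirlFlat` holds: proved by `Summit.NavierStokesRegularity.NavierStokesRegularity.Theorems.flatSwirlGauge_axisymmetricSwirlFlat_proof` (its module imports this route file, so no `_holds` link can be stated here).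

/-- item stmt-NavierStokesRegularity-0055 · support · rank 9 · closed · proved by Summit.NavierStokesRegularity.NavierStokesRegularity.Theorems.typeICertificateLadder_noBlowupToClay_proof @ 8d57e70af7e2 (prover) · by planner
sources: Leray1934, Fefferman2000
Given NoBlowup, build the Clay (A) solution: local finite-energy classical solution for smooth
divergence-free rapidly decaying data (Leray 1934 §III / Fujita–Kato 1964 + LPS smoothing), continue
past every T using NoBlowup, glue by weak–strong uniqueness (Prodi–Serrin), bounded energy from the
energy inequality, and convert with
Literature.Analysis.FluidPDE.isNavierStokesSolution_and_smooth_iff. Blow-up at spatial infinity is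
excluded by CKN ε-regularity applied far out. May take named Literature facts (leray_existence_R3,
ladyzhenskaya_prodi_serrin, weak_strong_uniqueness, fujita_kato_local) as hypotheses if the grounder
so rules. -/
@[route_item "route-NavierStokesRegularity-FlatSwirlGauge", crux]
def NoBlowupToClay : Prop :=
  (∀ (ν T : ℝ), 0 < ν → 0 < T → ∀ (u : ℝ → EuclideanSpace ℝ (Fin 3) → EuclideanSpace ℝ (Fin 3)) (p : ℝ → EuclideanSpace ℝ (Fin 3) → ℝ), Literature.Analysis.FluidPDE.IsClassicalNSSolutionOn (Set.Ico 0 T) ν 0 u p → Literature.Analysis.FluidPDE.IsLerayHopfOn T ν 0 (u 0) u → Literature.Analysis.FluidPDE.HasRapidSpatialDecay (u 0) → Literature.Analysis.FluidPDE.HasSmoothExtensionPast ν 0 u T) → NavierStokesRegularity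

/-- `NoBlowupToClay` holds: proved by `Summit.NavierStokesRegularity.NavierStokesRegularity.Theorems.typeICertificateLadder_noBlowupToClay_proof` @ 8d57e70af7e2. -/
theorem NoBlowupToClay_holds : NoBlowupToClay := _root_.Summit.NavierStokesRegularity.NavierStokesRegularity.Theorems.typeICertificateLadder_noBlowupToClay_proof

/-- item stmt-NavierStokesRegularity-0056 · support · rank 9 · open · by planner
sources: KNSS2009, Seregin2012, Tao2021QuantitativeNS
If a finite-energy classical solution from a rapidly decaying datum has maximal lifespan T<∞ (no
classical extension past T), then ‖u(t)‖_∞ ≤ C (T−t)^{-1/2} eventually as t↑T (Leray's rate is the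
matching lower bound, leray_blowup_rate_top). The hardest and most informative crux: a
counterexample is a Type II singularity, i.e. ¬(Clay A). Known: lower bound c√ν (T−t)^{-1/2} (Leray
1934 §20); L³ must blow up (ESS 2003, Seregin 2012); only triple-log quantitative gain (Tao 2021). -/
@[route_item "route-NavierStokesRegularity-FlatSwirlGauge"]
def NoTypeII : Prop :=
  ∀ (ν T : ℝ), 0 < ν → 0 < T → ∀ (u : ℝ → EuclideanSpace ℝ (Fin 3) → EuclideanSpace ℝ (Fin 3)) (p : ℝ → EuclideanSpace ℝ (Fin 3) → ℝ), Literature.Analysis.FluidPDE.IsMaximalSmoothSolution ν 0 u p T → Literature.Analysis.FluidPDE.IsLerayHopfOn T ν 0 (u 0) u → Literature.Analysis.FluidPDE.HasRapidSpatialDecay (u 0) → Literature.Analysis.FluidPDE.IsTypeIBlowup u T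

/-- item stmt-NavierStokesRegularity-1257 · support · rank 10 · closed · proved by Summit.NavierStokesRegularity.NavierStokesRegularity.Theorems.flatSwirlGauge_typeIAssembly_proof @ c4c6c847fede (prover) · by planner
sources: SereginSverak2009, KNSS2009
[support] TYPE-I VARIANT OF THE ASSEMBLY — PURE LOGIC (proved in the planner's Sketch.lean, term
below): FlatGaugeAtSingularity → FlatGaugeExcludesTypeI → NoTypeII → LocalBoundedExtends →
NoBlowupToClay → NavierStokesRegularity. Proof: apply NoBlowupToClay; given (ν,T,u,p) classical
Leray–Hopf from Clay data, by contradiction ¬HasSmoothExtensionPast makes (u,p) an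
IsMaximalSmoothSolution, NoTypeII gives IsTypeIBlowup u T, then at every x₀ either u is bounded on a
backward cylinder or FlatGaugeAtSingularity + FlatGaugeExcludesTypeI make it so; LocalBoundedExtends
yields the extension — contradiction. Lean: `by intro hFG hTI hNT2 hLBE hClay; apply hClay; intro ν
T hν hT u p hcl hLH hdec; by_contra hne; have hrate := hNT2 ν T hν hT u p ⟨hcl, hne⟩ hLH hdec; exact
hne (hLBE ν T hν hT u p hcl hLH hdec (fun x₀ => by by_cases hb : (∃ r : ℝ, 0 < r ∧ ∃ K : ℝ, ∀ t ∈
Set.Ioo (T - r ^ 2) T, 0 ≤ t → ∀ x ∈ Metric.ball x₀ r, ‖u t x‖ ≤ K); exact hb; exact hTI ν T hν hT u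
p hcl hLH hdec hrate x₀ (hFG ν T hν hT u p hcl hLH hdec x₀ hb)))`. -/
@[route_item "route-NavierStokesRegularity-FlatSwirlGauge"]
def TypeIAssembly : Prop :=
  FlatGaugeAtSingularity → FlatGaugeExcludesTypeI → NoTypeII → LocalBoundedExtends → NoBlowupToClay → NavierStokesRegularity

-- `TypeIAssembly` holds: proved by `Summit.NavierStokesRegularity.NavierStokesRegularity.Theorems.flatSwirlGauge_typeIAssembly_proof` @ c4c6c847fede (its module imports this route file, so no `_holds` link can be stated here).

/-- item stmt-NavierStokesRegularity-1258 · assembly · rank 1 · closed · proved by Summit.NavierStokesRegularity.NavierStokesRegularity.Theorems.flatSwirlGauge_assembly_proof (prover) · by planner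
sources: KNSS2009, Constantin2001
[assembly] PURE LOGIC (proved in the planner's Sketch.lean): FlatGaugeAtSingularity →
CriticalSwirlRegularity → LocalBoundedExtends → NoBlowupToClay → NavierStokesRegularity. Lean: `by
intro hFG hCSR hLBE hClay; apply hClay; intro ν T hν hT u p hcl hLH hdec; apply hLBE ν T hν hT u p
hcl hLH hdec; intro x₀; by_cases hb : (∃ r : ℝ, 0 < r ∧ ∃ K : ℝ, ∀ t ∈ Set.Ioo (T - r ^ 2) T, 0 ≤ t
→ ∀ x ∈ Metric.ball x₀ r, ‖u t x‖ ≤ K); exact hb; exact hCSR ν T hν hT u p hcl hLH hdec x₀ (hFG ν T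
hν hT u p hcl hLH hdec x₀ hb)`. All mathematics sits in the two cruxes and the standard support
LocalBoundedExtends; NoBlowupToClay is the shared stmt-NavierStokesRegularity-0055. -/
@[route_item "route-NavierStokesRegularity-FlatSwirlGauge"]
def Assembly : Prop :=
  FlatGaugeAtSingularity → CriticalSwirlRegularity → LocalBoundedExtends → NoBlowupToClay → NavierStokesRegularity

-- `Assembly` holds: proved by `Summit.NavierStokesRegularity.NavierStokesRegularity.Theorems.flatSwirlGauge_assembly_proof` (its module imports this route file, so no `_holds` link can be stated here).

/-! D-0027 §2.1 — DECIDING THEOREM (planner-authored via `route open/edit --closes-file`; by planner-rbadge-NavierStokesRegularity-FlatSwir-474f7d0e-g2-0 2026-08-15T16:08:04Z):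
its hypotheses are this route's items and its conclusion the sub-problem Statement (glue_lint), and it elaborates with this file. -/

@[closes "route-NavierStokesRegularity-FlatSwirlGauge"] theorem closes (hFG : FlatGaugeAtSingularity) (hCSR : CriticalSwirlRegularity)
    (hLBE : LocalBoundedExtends) (hClay : NoBlowupToClay) : NavierStokesRegularity := by
  apply hClay
  intro ν T hν hT u p hcl hLH hdec
  apply hLBE ν T hν hT u p hcl hLH hdec
  intro x₀
  by_cases hb : (∃ r : ℝ, 0 < r ∧ ∃ K : ℝ, ∀ t ∈ Set.Ioo (T - r ^ 2) T, 0 ≤ t → ∀ x ∈ Metric.ball x₀ r, ‖u t x‖ ≤ K)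
  · exact hb
  · exact hCSR ν T hν hT u p hcl hLH hdec x₀ (hFG ν T hν hT u p hcl hLH hdec x₀ hb)

end Summit.NavierStokesRegularity.NavierStokesRegularity.Theses.FlatSwirlGauge
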